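import Literature.NumberTheory.DiophantineGeometry.AbcDepthCensusTurbo

/-!
# A certified census of abc triples by 5-depth in boxes `c ≤ N` — the `a ↔ b` symmetry of the turbo checker

Sixth layer.  The pattern tree lists every depth pattern `(A, B, C)` together with its mirror image
`(B, A, C)`, and an abc triple `(a, b, c)` is visited through the one exactly when its mirror `(b, a, c)`
(again an abc triple, of the same depth) is visited through the other.  For a per-candidate test that is
SYMMETRIC in `a, b` (`test a b c = test b a c`: the always-failing test, the coprimality test, hit and
member lists read in both orientations) it therefore suffices to run the per-pattern walk on the patterns
with `A ≤ B` only — half of them (`A = B` forces `A = B = 1`).  `checkTurboChunkSym` does exactly this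
(`loopTurbo` behind the guard `B < A → accept`), and `checkTurboChunksSym_sound` is the soundness statement
of the previous layers under the extra hypothesis of symmetry; `depth_lt_of_checkTurboChunksSym`,
`depth_lt_of_checkTurboChunksSym_gcd`, `members_complete_of_checkTurboChunksSym` follow.  The proof re-runs
the exhaustiveness argument of `sound_of_forall_patterns` for the triple and for its mirror and compares
the two patterns it produces (`asgProd` of the mirrored assignment swaps the first two part products).

No axiom beyond `propext`, `Classical.choice`, `Quot.sound`; compiled evaluations live with the consumers.
Source of the algorithm: this project; the facts certified are finite computations.
-/

namespace Literature.NumberTheory.DiophantineGeometry.DepthCensus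

/-! ## The pattern of a triple, with its mirror -/

/-- **The depth pattern of an abc triple and of its mirror.** For an abc triple with `c ≤ N < (R+1)⁵` and
`ω₅(abc) ≥ K` there is a pattern `(A, B, C)` of `patterns N (deepPrimes N R) K 1 1 1` with `A ∣ a`,
`B ∣ b`, `C ∣ c`, positive parts, whose mirror `(B, A, C)` is a pattern too. [folklore] -/
theorem exists_pattern_and_mirror {N R K : ℕ} (hR : N < (R + 1) ^ 5) {a b c : ℕ}
    (habc : IsABCTriple a b c) (hcN : c ≤ N)
    (hK : K ≤ ((a * b * c).primeFactors.filter (fun p => 5 ≤ (a * b * c).factorization p)).card) :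
    ∃ A B C : ℕ, (A, B, C) ∈ patterns N (deepPrimes N R) K 1 1 1 ∧
      (B, A, C) ∈ patterns N (deepPrimes N R) K 1 1 1 ∧ 0 < A ∧ 0 < B ∧ 0 < C ∧ A ∣ a ∧ B ∣ b ∧ C ∣ c := by
  obtain ⟨ha, hb, hsum, hcop⟩ := habc
  have hc : 0 < c := by omega
  have habc0 : a * b * c ≠ 0 := by positivity
  obtain ⟨S, hSsub, hScard⟩ := Finset.exists_subset_card_eq hK
  have hS : ∀ p ∈ S, p.Prime ∧ p ^ 5 ∣ a * b * c := by
    intro p hp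
    have hp' := hSsub hp
    rw [Finset.mem_filter, Nat.mem_primeFactors] at hp'
    exact ⟨hp'.1.1, (hp'.1.1.pow_dvd_iff_le_factorization habc0).mpr hp'.2⟩
  -- the assignment and its mirror
  set τ : ℕ → Fin 3 := fun p => if p ^ 5 ∣ a then 0 else if p ^ 5 ∣ b then 1 else 2 with hτ
  set τ' : ℕ → Fin 3 := fun p => if p ^ 5 ∣ b then 0 else if p ^ 5 ∣ a then 1 else 2 with hτ'
  set T : List ℕ := (deepPrimes N R).filter (· ∈ S) with hT
  have hTsub : T.Sublist (deepPrimes N R) := List.filter_sublist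
  have hmemT : ∀ p, p ∈ T ↔ p ∈ S := by
    intro p
    simp only [hT, List.mem_filter, decide_eq_true_eq, mem_deepPrimes]
    constructor
    · exact fun h => h.2
    · intro hp
      obtain ⟨hpr, hdvd⟩ := hS p hp
      have hp5 : p ^ 5 ≤ N := by
        rcases pow_dvd_or ⟨ha, hb, hsum, hcop⟩ hpr hdvd with h | h | h
        · exact (Nat.le_of_dvd ha h).trans (by omega)
        · exact (Nat.le_of_dvd hb h).trans (by omega)
        · exact (Nat.le_of_dvd hc h).trans hcN
      refine ⟨⟨?_, hpr, hp5⟩, hp⟩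
      by_contra hlt
      have : (R + 1) ^ 5 ≤ p ^ 5 := Nat.pow_le_pow_left (by omega) 5
      omega
  have hTnd : T.Nodup := (deepPrimes_nodup N R).filter _
  have hTpr : ∀ p ∈ T, p.Prime := fun p hp => (hS p ((hmemT p).mp hp)).1
  have hTlen : T.length = K := by
    rw [← List.toFinset_card_of_nodup hTnd, ← hScard]
    congr 1
    ext p
    rw [List.mem_toFinset, hmemT]
  -- no deep prime power divides both `a` and `b`
  have hnot : ∀ p ∈ T, p ^ 5 ∣ b → ¬ p ^ 5 ∣ a := by
    intro p hp hpb hpa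
    have hpr := hTpr p hp
    have h1 : p ∣ Nat.gcd a b :=
      Nat.dvd_gcd (dvd_trans (dvd_pow_self p (by norm_num)) hpa)
        (dvd_trans (dvd_pow_self p (by norm_num)) hpb)
    rw [hcop] at h1
    exact hpr.one_lt.ne' (Nat.dvd_one.mp h1)
  -- what the assignments mean
  have hτa : ∀ p, τ p = 0 → p ^ 5 ∣ a := by
    intro p hp
    by_contra hn
    simp only [hτ, hn, if_false] at hp
    split_ifs at hp <;> exact absurd hp (by decide)
  have hτb : ∀ p, τ p = 1 → p ^ 5 ∣ b := by
    intro p hp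
    by_contra hn
    simp only [hτ, hn, if_false] at hp
    split_ifs at hp <;> exact absurd hp (by decide)
  have hτc : ∀ p ∈ T, τ p = 2 → p ^ 5 ∣ c := by
    intro p hpT hp
    obtain ⟨hpr, hdvd⟩ := hS p ((hmemT p).mp hpT)
    rcases pow_dvd_or ⟨ha, hb, hsum, hcop⟩ hpr hdvd with h | h | h
    · simp [hτ, h] at hp
    · have hna : ¬ p ^ 5 ∣ a := by
        intro h'
        simp [hτ, h'] at hp
      simp [hτ, hna, h] at hp
    · exact h
  have hτ'b : ∀ p, τ' p = 0 → p ^ 5 ∣ b := by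
    intro p hp
    by_contra hn
    simp only [hτ', hn, if_false] at hp
    split_ifs at hp <;> exact absurd hp (by decide)
  have hτ'a : ∀ p, τ' p = 1 → p ^ 5 ∣ a := by
    intro p hp
    by_contra hn
    simp only [hτ', hn, if_false] at hp
    split_ifs at hp <;> exact absurd hp (by decide)
  have hτ'c : ∀ p ∈ T, τ' p = 2 → p ^ 5 ∣ c := by
    intro p hpT hp
    obtain ⟨hpr, hdvd⟩ := hS p ((hmemT p).mp hpT)
    rcases pow_dvd_or ⟨ha, hb, hsum, hcop⟩ hpr hdvd with h | h | h
    · have hnb : ¬ p ^ 5 ∣ b := fun h' => hnot p hpT h' h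
      simp [hτ', hnb, h] at hp
    · simp [hτ', h] at hp
    · exact h
  -- the mirrored assignment swaps the first two part products
  have hswap0 : asgProd τ' 0 T = asgProd τ 1 T := by
    unfold asgProd
    congr 1
    apply List.map_congr_left
    intro p hp
    have e1 : (τ' p = 0) ↔ p ^ 5 ∣ b := by
      constructor
      · exact hτ'b p
      · intro h; simp [hτ', h]
    have e2 : (τ p = 1) ↔ p ^ 5 ∣ b := by
      constructor
      · exact hτb p
      · intro h; simp [hτ, hnot p hp h, h]
    by_cases h : p ^ 5 ∣ b
    · rw [if_pos (e1.mpr h), if_pos (e2.mpr h)]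
    · rw [if_neg (fun h' => h (e1.mp h')), if_neg (fun h' => h (e2.mp h'))]
  have hswap1 : asgProd τ' 1 T = asgProd τ 0 T := by
    unfold asgProd
    congr 1
    apply List.map_congr_left
    intro p hp
    have e1 : (τ' p = 1) ↔ p ^ 5 ∣ a := by
      constructor
      · exact hτ'a p
      · intro h
        have hnb : ¬ p ^ 5 ∣ b := fun h' => hnot p hp h' h
        simp [hτ', hnb, h]
    have e2 : (τ p = 0) ↔ p ^ 5 ∣ a := by
      constructor
      · exact hτa p
      · intro h; simp [hτ, h]
    by_cases h : p ^ 5 ∣ a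
    · rw [if_pos (e1.mpr h), if_pos (e2.mpr h)]
    · rw [if_neg (fun h' => h (e1.mp h')), if_neg (fun h' => h (e2.mp h'))]
  have hswap2 : asgProd τ' 2 T = asgProd τ 2 T := by
    have h3 := asgProd_mul_mul τ T
    have h3' := asgProd_mul_mul τ' T
    rw [hswap0, hswap1] at h3'
    have hpos : 0 < asgProd τ 1 T * asgProd τ 0 T :=
      Nat.mul_pos (one_le_asgProd τ 1 (fun p hp => (hTpr p hp).one_le))
        (one_le_asgProd τ 0 (fun p hp => (hTpr p hp).one_le))
    have : asgProd τ 1 T * asgProd τ 0 T * asgProd τ' 2 T =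
        asgProd τ 1 T * asgProd τ 0 T * asgProd τ 2 T := by
      rw [h3', ← h3]; ring
    exact Nat.eq_of_mul_eq_mul_left hpos this
  -- divisibilities and bounds
  have hA : asgProd τ 0 T ∣ a := asgProd_dvd hTnd hTpr (fun p _ hp => hτa p hp)
  have hB : asgProd τ 1 T ∣ b := asgProd_dvd hTnd hTpr (fun p _ hp => hτb p hp)
  have hC : asgProd τ 2 T ∣ c := asgProd_dvd hTnd hTpr hτc
  have hAle : 1 * asgProd τ 0 T ≤ N := by
    rw [one_mul]; exact (Nat.le_of_dvd ha hA).trans (by omega)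
  have hBle : 1 * asgProd τ 1 T ≤ N := by
    rw [one_mul]; exact (Nat.le_of_dvd hb hB).trans (by omega)
  have hCle : 1 * asgProd τ 2 T ≤ N := by
    rw [one_mul]; exact (Nat.le_of_dvd hc hC).trans hcN
  have hABC : 4 * ((1 * asgProd τ 0 T) * (1 * asgProd τ 1 T) * (1 * asgProd τ 2 T)) ≤ N ^ 3 := by
    simp only [one_mul]
    calc 4 * (asgProd τ 0 T * asgProd τ 1 T * asgProd τ 2 T) ≤ 4 * (a * b * c) :=
          Nat.mul_le_mul_left 4 (Nat.mul_le_mul (Nat.mul_le_mul (Nat.le_of_dvd ha hA)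
            (Nat.le_of_dvd hb hB)) (Nat.le_of_dvd hc hC))
      _ ≤ N ^ 3 := four_mul_le_cube hsum hcN
  have hsorted := deepPrimes_sorted N R
  have hone : ∀ p ∈ deepPrimes N R, 1 ≤ p := fun p hp => (mem_deepPrimes.mp hp).2.1.one_le
  have hmem := mem_patterns N (deepPrimes N R) K 1 1 1 T τ hTsub hTlen hsorted hone hAle hBle hCle hABC
  -- the mirror pattern, from the mirrored assignment
  have hA'le : 1 * asgProd τ' 0 T ≤ N := by rw [hswap0]; exact hBle
  have hB'le : 1 * asgProd τ' 1 T ≤ N := by rw [hswap1]; exact hAle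
  have hC'le : 1 * asgProd τ' 2 T ≤ N := by rw [hswap2]; exact hCle
  have hABC' : 4 * ((1 * asgProd τ' 0 T) * (1 * asgProd τ' 1 T) * (1 * asgProd τ' 2 T)) ≤ N ^ 3 := by
    rw [hswap0, hswap1, hswap2]
    calc 4 * ((1 * asgProd τ 1 T) * (1 * asgProd τ 0 T) * (1 * asgProd τ 2 T))
        = 4 * ((1 * asgProd τ 0 T) * (1 * asgProd τ 1 T) * (1 * asgProd τ 2 T)) := by ring
      _ ≤ N ^ 3 := hABC
  have hmem' := mem_patterns N (deepPrimes N R) K 1 1 1 T τ' hTsub hTlen hsorted hone hA'le hB'le hC'le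
    hABC'
  rw [hswap0, hswap1, hswap2] at hmem'
  simp only [one_mul] at hmem hmem'
  have h1 : ∀ d, 0 < asgProd τ d T := fun d => one_le_asgProd τ d (fun p hp => (hTpr p hp).one_le)
  exact ⟨_, _, _, hmem, hmem', h1 0, h1 1, h1 2, hA, hB, hC⟩

/-! ## The symmetric turbo chunk checker -/

/-- The per-pattern walk behind the symmetry guard: patterns with `B < A` are accepted unseen (their
mirrors `(B, A, C)`, `B < A`, are walked). [folklore] -/
def loopTurboSym (N A B C : ℕ) (test : ℕ → ℕ → ℕ → Bool) : Bool :=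
  if B < A then true else loopTurbo N A B C test

/-- **One chunk of the symmetric turbo cell check** (for tests symmetric in `a, b`). [folklore] -/
def checkTurboChunkSym (N R K : ℕ) (π : List (Fin 4)) (test : ℕ → ℕ → ℕ → Bool) : Bool :=
  turboFollow N (fun A B C => loopTurboSym N A B C test) π (turboTable N R K) K 1 1 1 1

/-- **Soundness of the symmetric turbo chunked check.** If `test` is symmetric in its first two
arguments, `N < (R+1)⁵`, `S` covers some depth `d`, and every chunk named in `S` is accepted, then `test`
holds on every abc triple with `c ≤ N` and `ω₅(abc) ≥ K`. [folklore] -/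
theorem checkTurboChunksSym_sound {N R K : ℕ} {test : ℕ → ℕ → ℕ → Bool}
    (hsym : ∀ a b c, test a b c = test b a c) (hR : N < (R + 1) ^ 5)
    {S : List (List (Fin 4))} {d : ℕ} (hS : coversAll S d = true)
    (h : ∀ s ∈ S, checkTurboChunkSym N R K s test = true) {a b c : ℕ} (habc : IsABCTriple a b c)
    (hcN : c ≤ N)
    (hK : K ≤ ((a * b * c).primeFactors.filter (fun p => 5 ≤ (a * b * c).factorization p)).card) :
    test a b c = true := by
  -- every pattern is accepted by the guarded walk
  have hall : ∀ t ∈ patterns N (deepPrimes N R) K 1 1 1,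
      loopTurboSym N t.1 t.2.1 t.2.2 test = true := by
    intro t ht
    obtain ⟨s, hs, hts⟩ := exists_mem_followPrefix_of_coversAll hS ht
    have hrun := h s hs
    rw [← turboTable_map_fst N R K] at hts
    exact turboFollow_sound N K (fun A B C => loopTurboSym N A B C test) s (turboTable N R K) K 1 1 1 1
      (turboTable_ok N R K) (by rw [turboTable_map_fst]; exact deepPrimes_sorted N R)
      (fun e he => by
        simp only [turboTable, List.mem_map] at he
        obtain ⟨p, hp, rfl⟩ := he
        exact (mem_deepPrimes.mp hp).2.1.pos)
      le_rfl (by ring) hrun t hts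
  obtain ⟨A, B, C, hmem, hmem', hA0, hB0, hC0, hA, hB, hC⟩ :=
    exists_pattern_and_mirror hR habc hcN hK
  obtain ⟨ha, hb, hsum, hcop⟩ := habc
  by_cases hlt : B < A
  · -- walk the mirror pattern on the mirror triple
    have hrun := hall _ hmem'
    simp only [loopTurboSym, if_neg (lt_asymm hlt)] at hrun
    rw [hsym]
    exact loopTurbo_sound hB0 hA0 hC0 hrun hB hA hC hb ha (by omega) hcN
  · have hrun := hall _ hmem
    simp only [loopTurboSym, if_neg hlt] at hrun
    exact loopTurbo_sound hA0 hB0 hC0 hrun hA hB hC ha hb hsum hcN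

/-- **Empty cells (symmetric turbo).** [folklore] -/
theorem depth_lt_of_checkTurboChunksSym {N R K : ℕ} (hR : N < (R + 1) ^ 5)
    {S : List (List (Fin 4))} {d : ℕ} (hS : coversAll S d = true)
    (h : ∀ s ∈ S, checkTurboChunkSym N R K s (fun _ _ _ => false) = true) {a b c : ℕ}
    (habc : IsABCTriple a b c) (hcN : c ≤ N) :
    ((a * b * c).primeFactors.filter (fun p => 5 ≤ (a * b * c).factorization p)).card < K := by
  by_contra hK
  exact Bool.false_ne_true
    (checkTurboChunksSym_sound (fun _ _ _ => rfl) hR hS h habc hcN (not_lt.mp hK))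

/-- **No abc triple in the cell-in-the-box (symmetric turbo)**, from the test "`gcd(a,b) ≠ 1`".
[folklore] -/
theorem depth_lt_of_checkTurboChunksSym_gcd {N R K : ℕ} (hR : N < (R + 1) ^ 5)
    {S : List (List (Fin 4))} {d : ℕ} (hS : coversAll S d = true)
    (h : ∀ s ∈ S, checkTurboChunkSym N R K s (fun a b _ => !(Nat.gcd a b == 1)) = true) {a b c : ℕ}
    (habc : IsABCTriple a b c) (hcN : c ≤ N) :
    ((a * b * c).primeFactors.filter (fun p => 5 ≤ (a * b * c).factorization p)).card < K := by
  by_contra hK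
  have hrun := checkTurboChunksSym_sound (test := fun a b _ => !(Nat.gcd a b == 1))
    (fun a b _ => by rw [Nat.gcd_comm]) hR hS h habc hcN (not_lt.mp hK)
  have hcop : Nat.gcd a b = 1 := habc.2.2.2
  simp [hcop] at hrun

/-- The member test read in both orientations is symmetric. [folklore] -/
theorem memberTest_symm (Lm : List (ℕ × ℕ × ℕ)) (a b c : ℕ) :
    (!(Nat.gcd a b == 1) || (Lm.elem (a, b, c) || Lm.elem (b, a, c))) =
      (!(Nat.gcd b a == 1) || (Lm.elem (b, a, c) || Lm.elem (a, b, c))) := by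
  rw [Nat.gcd_comm, Bool.or_comm (Lm.elem (a, b, c))]

/-- **Members (symmetric turbo).** With the member test — "`gcd(a,b) ≠ 1`, or `(a,b,c)` is listed in one of
the two orientations" — every abc triple of the cell `{ω₅ ≥ K}` in the box `{c ≤ N}` is listed.
[folklore] -/
theorem members_complete_of_checkTurboChunksSym {N R K : ℕ} {Lm : List (ℕ × ℕ × ℕ)}
    (hR : N < (R + 1) ^ 5) {S : List (List (Fin 4))} {d : ℕ} (hS : coversAll S d = true)
    (h : ∀ s ∈ S, checkTurboChunkSym N R K s
      (fun a b c => !(Nat.gcd a b == 1) || (Lm.elem (a, b, c) || Lm.elem (b, a, c))) = true)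
    {a b c : ℕ} (habc : IsABCTriple a b c) (hcN : c ≤ N)
    (hK : K ≤ ((a * b * c).primeFactors.filter (fun p => 5 ≤ (a * b * c).factorization p)).card) :
    (a, b, c) ∈ Lm ∨ (b, a, c) ∈ Lm := by
  have hrun := checkTurboChunksSym_sound
    (test := fun a b c => !(Nat.gcd a b == 1) || (Lm.elem (a, b, c) || Lm.elem (b, a, c)))
    (memberTest_symm Lm) hR hS h habc hcN hK
  have hcop : Nat.gcd a b = 1 := habc.2.2.2
  simp only [hcop, beq_self_eq_true, Bool.not_true, Bool.false_or, Bool.or_eq_true] at hrun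
  rcases hrun with h1 | h1
  · exact Or.inl (List.mem_of_elem_eq_true h1)
  · exact Or.inr (List.mem_of_elem_eq_true h1)

end Literature.NumberTheory.DiophantineGeometry.DepthCensus
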